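import Mathlib
import HarnessLib
import Summits.HubbardSuperconductivity.HubbardSuperconductivity.Theses.KLProgramme
import Summits.HubbardSuperconductivity.HubbardSuperconductivity.Theorems.KLProgrammeKLRegimeSplitGlueV14P4Ex

/-!
# Route `KLProgramme` — crux K3 gen 5, the GLUE item `KLRegimeTwoPointLimitGlueV14 := KLRegimeEngineV14 → KLRegimeBetaSplitV14 → KLRegimeCountertermV14 →
# KLRegimeVolumeLimitV14 → KLRegimeTwoPointAssemblyV14 → KLRegimeTwoPointLimit` (stmt-HubbardSuperconductivity-19923) CLOSED AT BIRTH by `KLRegimeSplit.KLRegimeInductionV14P4Ex`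
# (route rev 17, gen-5 resplit 2026-08-27T03:18Z; closer p488950, seat p2; template plan2 g4, pattern = `…TwoPointLimitGlueV12P4Closes` p477755).  Nothing asserts superconductivity.
-/

noncomputable section

namespace Summit.HubbardSuperconductivity.HubbardSuperconductivity.Theorems.KLRegimeSplit

set_option linter.dupNamespace false -- summit = problem name (single-conjunct summit), D-0017

/-- The gen-5 glue item holds: the five V14 children imply `KLRegimeTwoPointLimit`. -/
theorem klRegimeTwoPointLimitGlueV14_holds :
    Summit.HubbardSuperconductivity.HubbardSuperconductivity.Theses.KLProgramme.KLRegimeTwoPointLimitGlueV14 :=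
  fun h₁ h₂ h₃ h₄ h₅ => KLRegimeInductionV14P4Ex h₁ h₂ h₃ h₄ h₅

end Summit.HubbardSuperconductivity.HubbardSuperconductivity.Theorems.KLRegimeSplit

end
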